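import Literature.NumberTheory.PAdicHodge.CrystallineBaseChange
import Literature.NumberTheory.PAdicHodge.DeRhamBaseChangeProofs
import HarnessLib

/-!
# `CrystallineBaseChange`: the sectors that hold today, and what blocks the discharge

Sibling proof file of `Literature/NumberTheory/PAdicHodge/CrystallineBaseChange.lean` (D-0014), home
of the eventual `theorem CrystallineBaseChange_holds`.  The named fact says: for a continuous embedding
`K → L` of characteristic-`0` non-archimedean local fields of residue characteristic `ℓ` and a framed
`ρ : Γ_K →ₜ* GL_n(ℚ̄_ℓ)` crystalline for THE pinned datum `fontainePst K ℓ hK`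
(`PstWeilDeligneData.IsCrystallineFramed`: de Rham, and an attached Weil–Deligne representation that
is unramified with `N = 0`), the restriction `ρ ∘ absGaloisRestrict K L` is crystalline for
`fontainePst L ℓ hL`.

In print (for Fontaine's genuine `B_cris ⊆ B_dR`) this is elementary: `B_cris` is built from
`𝒪_{C_K}` with its Galois action alone, `C_K = C_L` for `L/K` finite, so `B_cris`-admissibility of
`V` as a `G_K`-representation restricts to `G_L` (Fontaine 1994, Exp. III §5.1, Exp. VIII §2.3.7;
Brinon–Conrad 2009, §9.3 p. 146: "the induction … has trivial `G_{K'}`-action (so it is crystalline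
as a `G_{K'}`-representation)", the converse failing for ramified `K'/K`; the de Rham analogue is
Prop. 6.3.8, discharged in the tree as `DeRhamBaseChange_holds`).

## What is here (theorems only; no definition, no new named fact, no `sorry`)

* `isDeRhamFramed_comp_of_isCrystallineFramed` — the DE RHAM HALF of the conclusion holds outright:
  `ρ` crystalline for `fontainePst K ℓ hK` ⇒ `ρ ∘ res` de Rham for `fontainePst L ℓ hL`
  (`DeRhamBaseChange_holds`: the period rings of THE data ARE the constructions `bdRPeriodRingData`,
  clause (F9), and `B_dR(K) ≃ B_dR(L)` equivariantly, file `DeRhamBaseChangeProofs`).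
* `CrystallineBaseChange.of_isLocallyUnramified` — the UNRAMIFIED SECTOR holds outright: if `ρ` is
  trivial on `I_K` then `ρ ∘ res` is trivial on `I_L` (`res(I_L) ≤ I_K`,
  `absInertia_map_absGaloisRestrict_le_holds`) and unramified representations are crystalline for
  every datum (structure axioms `isDeRhamWith_of_isLocallyUnramified`, `exists_of_isDeRham`,
  `wd_of_isLocallyUnramified` of `PstWeilDeligneData`).

## What is NOT here, and why (status 2026-08-17)

`CrystallineBaseChange_holds` itself.  The Weil–Deligne half of THE datum — the relation
`(fontainePst F ℓ hℓ).IsWeilDeligneOf` — is pinned BY SPECIFICATION: `fontainePst` is Hilbert's `ε`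
over the data on `B_dR(F)` with the canonical `ℚ_ℓ`-structure, selected by the clauses
`IsFontaineDatum hℓ` (file `FontaineDpst`).  The choice is made independently at `K` and at `L`,
and the only constraints on `IsWeilDeligneOf` that hold unconditionally are the structure axioms of
`PstWeilDeligneData`, which decide "unramified with `N = 0`" exactly for locally unramified
representations (the sector above); under the named fact `FontaineDatumExists` the clauses add the
cyclotomic character (F4), the Frobenius normalisation on unramified representations (F8), the
existence of SOME crystalline extension data along the subfields of `K̄/K` (F10) and properties OF
crystalline representations ((F5)–(F7), (F12), (F13)) — none of which relates the datum at `K` to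
the datum at `L`.  Hence no argument available in the tree can derive the Weil–Deligne half for a
ramified crystalline `ρ` (e.g. `ρ = ε²`, or the regular-weight representations the consuming cruxes
feed in); the statement becomes a theorem when the Weil–Deligne half of `fontainePst` is the
CONSTRUCTION `WD ∘ D_pst` (definition item `defn-FontainePstWeilDeligneData`, component (iii): `B_st`,
`D_pst`, Fontaine's recipe, Berger's theorem), after which the printed argument (`B_cris(K) = B_cris(L)`,
`D_pst` and `WD` commute with restriction to `W_L`) applies.

## References

* [BrinonConrad2009] O. Brinon, B. Conrad, *CMI Summer School notes on p-adic Hodge theory*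
  (2009), Prop. 6.3.8 (p. 80); §9.3, p. 146 (crystalline/semistable restriction to `G_{K'}`;
  Prop. 9.3.1 for `K' = \widehat{K^{un}}`).
* [FontaineAsterisque223III] J.-M. Fontaine, *Représentations p-adiques semi-stables*, Astérisque 223
  (1994), Exp. III §5.1 (`B_cris`-admissible representations).
* [FontaineAsterisque223VIII] J.-M. Fontaine, *Représentations ℓ-adiques potentiellement
  semi-stables*, Astérisque 223 (1994), §2.3.7.
-/

noncomputable section

open Field ValuativeRel
open Literature.NumberTheory.GaloisRepresentations

namespace Literature.NumberTheory.PAdicHodge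

section Sectors

variable {K L : Type} [Field K] [ValuativeRel K] [TopologicalSpace K] [IsNonarchimedeanLocalField K]
  [CharZero K] [Field L] [ValuativeRel L] [TopologicalSpace L] [IsNonarchimedeanLocalField L]
  [CharZero L] [Algebra K L] {ℓ : ℕ} [Fact ℓ.Prime]

/-- **The de Rham half of `CrystallineBaseChange` holds outright**: for a continuous embedding
`K → L` of characteristic-`0` non-archimedean local fields of residue characteristic `ℓ` and a framed
`ρ : Γ_K →ₜ* GL_n(ℚ̄_ℓ)` crystalline for THE pinned datum `fontainePst K ℓ hK`, the restriction
`ρ ∘ absGaloisRestrict K L` is de Rham for `fontainePst L ℓ hL` — crystalline ⇒ de Rham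
(`IsCrystallineFramed.isDeRhamFramed`) and the discharged `DeRhamBaseChange_holds` (Brinon–Conrad
2009, Prop. 6.3.8: `V` de Rham as a `G_K`-representation ⇒ de Rham as a `G_{K'}`-representation).
[cite: BrinonConrad2009, Prop. 6.3.8] -/
theorem isDeRhamFramed_comp_of_isCrystallineFramed (hcont : Continuous (algebraMap K L))
    (hK : valuation K (ℓ : K) < 1) (hL : valuation L (ℓ : L) < 1) {n : ℕ}
    (ρ : FramedRep (absoluteGaloisGroup K) (PadicAlgCl ℓ) n)
    (hρ : (fontainePst K ℓ hK).IsCrystallineFramed ρ) :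
    (fontainePst L ℓ hL).IsDeRhamFramed (ρ.comp (absGaloisRestrict K L)) :=
  DeRhamBaseChange_holds K L hcont ℓ hK hL n ρ hρ.isDeRhamFramed

omit [CharZero K] in
/-- **The unramified sector of `CrystallineBaseChange` holds outright** (no continuity, no pin
needed): if `ρ : Γ_K →ₜ* GL_n(ℚ̄_ℓ)` is trivial on the inertia group `I_K`, then
`ρ ∘ absGaloisRestrict K L` is trivial on `I_L` (restriction maps `I_L` into `I_K`,
`absInertia_map_absGaloisRestrict_le_holds`; Serre, *Local Fields* I §7), and unramified
representations are crystalline for EVERY datum — de Rham with an attached Weil–Deligne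
representation that has `N = 0` and trivial inertia (structure axioms of `PstWeilDeligneData`,
`PstWeilDeligneData.isCrystallineFramed_of_isLocallyUnramified`; Fontaine 1994, Exp. III §5:
unramified ⇒ crystalline; Brinon–Conrad 2009, Prop. 9.3.1 and Cor. 9.3.2: crystallinity is
insensitive to inertial restriction, so a representation trivial on `I_K` is crystalline).  This is
the whole part of the fact that the tree decides unconditionally today (see the module docstring).
[cite: FontaineAsterisque223III, Exp. III §5.1] [cite: BrinonConrad2009, Prop. 9.3.1 and Cor. 9.3.2] -/
theorem CrystallineBaseChange.of_isLocallyUnramified (hL : valuation L (ℓ : L) < 1) {n : ℕ}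
    (ρ : FramedRep (absoluteGaloisGroup K) (PadicAlgCl ℓ) n) (hρ : ρ.IsLocallyUnramified) :
    (fontainePst L ℓ hL).IsCrystallineFramed (ρ.comp (absGaloisRestrict K L)) := by
  refine (fontainePst L ℓ hL).isCrystallineFramed_of_isLocallyUnramified fun σ hσ => ?_
  rw [ContinuousMonoidHom.comp_toFun]
  exact hρ _ (absInertia_map_absGaloisRestrict_le_holds K L ⟨σ, hσ, rfl⟩)

end Sectors

end Literature.NumberTheory.PAdicHodge

end
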